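import Summits.BirchSwinnertonDyer.Rank1Residual.X2.GreenbergSelmerCountSplit
import HarnessLib

/-!
# `#(S^{Σ₀}_{E[p^∞]}(ℚ_∞) ⊓ H¹[p]) = p^{λ(E) + Σδ + e_p}` at ANY odd multiplicative prime `p ‖ N`
# (`e_p = 1` split, `0` non-split), and the `μ`-reading at the multiplicative member of route G

HONEST FRAMING (cell `b2b-bsdres`, run/shared/lean/b2b/bsd-rank1-residual/, verbatim in every
file): the goal of the cell is to DELETE the COMBINATION-SHAPED residual classes of the
Birch–Swinnerton-Dyer formula for ALL analytic-rank `≤ 1` elliptic curves over `ℚ` — "full BSD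
formula for every rank `≤ 1` curve in class `C`" assembled STRICTLY from published theorems — so
that the rank-`≤ 1` remainder becomes exactly the CONSTRUCTION-SHAPED classes, which are TYPED
(missing-input `Prop`s), NOT attempted. This is not "finishing BSD". Sub-cell
`b2b-bsdres-eisenstein-p2` (CLASS-OWNERS row "X2"), gen 13: research route; NO CLAIM BEYOND STATED
CLASSES; nothing here changes a label. Theorems only; axioms standard; no `sorry`.

WHAT THIS FILE PROVES (step K-D1 of the `p ‖ N` Λ-bookkeeping for route G; X2-GAP §12 "the
congruence invariant at `p ‖ N` is `Λ = λ_alg + e_p`"):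
* **`exists_data_natCard_eq_pow_multiplicative`** — for `E/ℚ` globally minimal, `p` ODD with `p ‖ N`
  (split OR non-split), `κ` cyclotomic with topological generator `γ`, `Σ₀ ∌ p` finite containing the
  bad primes `≠ p`, `μ(E) = 0`: ONE Tate data `L` above `p` with GV's `htriv`, `hgen`,
  `Sel^{Σ₀}_E(ℚ_∞)_p ≤ S^{Σ₀}_{E[p^∞]}(ℚ_∞)` and
  `#(S^{Σ₀}_{E[p^∞]}(ℚ_∞) ⊓ H¹[p]) = p^{λ + Σδ + e_p}`, `e_p = [p split]` (K-B2 ∪ K-C2);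
* **`exists_data_le_multiplicative`** — the same data WITHOUT the `μ = 0` hypothesis (no count);
* **`mu_eq_zero_of_natCard_ne_zero_multiplicative`** — if for such data `#(S^{Σ₀} ⊓ H¹[p]) ≠ 0`
  (e.g. because it equals the partner's `p`-power by the kernel transfer) then `μ(E) = 0`
  (`Sel^{Σ₀} ≤ S^{Σ₀}` so `Sel^{Σ₀}[p]` is finite; K-A's `μ`-reading from GV (7) at `p ‖ N`);
* **`mu_eq_zero_of_natCard_ne_zero_goodOrdinary`** — the good-ordinary twin (gen 11's argument in
  `MuTransferDerived`, isolated): `#(S^{Σ₀}_{E[p^∞]}(ℚ_∞) ⊓ H¹[p]) ≠ 0 ⇒ μ(E) = 0` (A111, A115).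
Inputs that are NOT tree theorems: A40/A41 (Tate uniformisation), GV (5)–(7) at `p ‖ N`, GV
Prop. (2.5)/p. 25, GV p. 15 (and A111/A115 for the good-ordinary twin); Kato's cotorsion as the
hypothesis `D.IsTorsion`.

References: Greenberg–Vatsal 2000 §1 (5)–(7), pp. 14–15, §2 Prop. (2.1), (2.5), (2.8), pp. 20, 25–27.
-/

noncomputable section

open scoped Classical AddSubgroup

universe u

namespace Summit.BirchSwinnertonDyer.Rank1Residual.X2.GreenbergSelmerCountMultiplicative

open NumberField IsDedekindDomain Field Literature.NumberTheory.GaloisRepresentations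
  Literature.NumberTheory.EllipticCurves Literature.NumberTheory.EllipticCurves.GreenbergSelmer
  Literature.NumberTheory.EllipticCurves.GreenbergVatsal2000 IsDedekindDomain.HeightOneSpectrum
  Summit.BirchSwinnertonDyer.Rank1Residual.X2.GreenbergVatsalTorsion
  Summit.BirchSwinnertonDyer.Rank1Residual.X2.GreenbergVatsalStrictSelmer
  Summit.BirchSwinnertonDyer.Rank1Residual.X2.GreenbergVatsalReductionDatum
  Summit.BirchSwinnertonDyer.Rank1Residual.X2.NonPrimitiveSelmerStrictEquality
  Summit.BirchSwinnertonDyer.Rank1Residual.X2.NonPrimitiveSelmerGVEquality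
  Summit.BirchSwinnertonDyer.Rank1Residual.X2.NonPrimitiveSelmerDual
  Summit.BirchSwinnertonDyer.Rank1Residual.X2.GreenbergVatsalTateDatumCofree
  Summit.BirchSwinnertonDyer.Rank1Residual.X2.NonPrimitiveSelmerCorank
  Summit.BirchSwinnertonDyer.Rank1Residual.X2.GreenbergSelmerCountNonsplit
  Summit.BirchSwinnertonDyer.Rank1Residual.X2.GreenbergSelmerCountSplit
  Summit.BirchSwinnertonDyer.Rank1Residual.X2.TrivialZeroCorankAlgebra

variable (W : WeierstrassCurve ℚ) [W.IsGloballyMinimal] [W.IsElliptic] (p : ℕ) [hp : Fact p.Prime]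
  (κ : ZpExtension ℚ p) {γ : absoluteGaloisGroup ℚ} (S₀ : Finset (HeightOneSpectrum (𝓞 ℚ)))

/-! ## §1. The unified count at `p ‖ N` -/

/-- **`#(S^{Σ₀}_{E[p^∞]}(ℚ_∞) ⊓ H¹[p]) = p^{λ(E) + Σ_{v∈Σ₀} δ_E^{(v)} + e_p}` at an odd `p ‖ N`, `μ(E) = 0`**,
with `e_p = 1` if the reduction is SPLIT and `e_p = 0` if NON-split — Greenberg–Vatsal's congruence
invariant `Λ = λ_alg + Σδ + e_p` at a multiplicative Eisenstein prime (X2-GAP §12) — for ONE Tate data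
`L` above `p` carrying GV's `htriv`, `hgen` and `Sel^{Σ₀}_E(ℚ_∞)_p ≤ S^{Σ₀}_{E[p^∞]}(ℚ_∞)`. Union of
`GreenbergSelmerCountNonsplit` (A41) and `GreenbergSelmerCountSplit` (A40).
[cite: GreenbergVatsal2000, §1 (5)–(7) pp. 7–8, pp. 14–15; §2 Prop. (2.1), (2.5), pp. 20, 25] -/
theorem exists_data_natCard_eq_pow_multiplicative
    (hT : Silverman1994_thmV53_corV54_tateUniformisation.{0})
    (hT' : Silverman1994_thmV53_tateUniformisation.{0})
    (hA : lambda_nonPrimitive_eq_add_sum_delta_multiplicative)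
    (hB : datumSelmer_divisible_of_finite_torsionBy)
    (hF : datumStrictSelmer_lt_datumSelmer_of_split)
    (hκ : κ.IsCyclotomic) (hγ : κ.IsTopGenerator γ) (hp2 : p ≠ 2)
    (hmult : W.HasMultiplicativeReductionAtPrime p)
    (hS₀ : ∀ v ∈ S₀, ((p : ℕ) : 𝓞 ℚ) ∉ v.asIdeal)
    (hS : ∀ v : HeightOneSpectrum (𝓞 ℚ), v ∉ S₀ → ((p : ℕ) : 𝓞 ℚ) ∉ v.asIdeal →
      W.HasGoodReductionAt v)
    (D : W.SelmerDualData κ γ) [Module.Finite (IwasawaAlgebra p) D.X] (hX : D.IsTorsion)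
    (hμ : D.mu = 0) :
    ∃ L : Data ℚ (W.geomPrimaryTorsion p) p,
      (∀ (v : HeightOneSpectrum (𝓞 ℚ)) (hv : ((p : ℕ) : 𝓞 ℚ) ∈ v.asIdeal),
        ∀ x ∈ inertia v, ∀ m : W.geomPrimaryTorsion p, x • m - m ∈ (L v hv).plus) ∧
      (∀ (v : HeightOneSpectrum (𝓞 ℚ)) (hv : ((p : ℕ) : 𝓞 ℚ) ∈ v.asIdeal),
        ∀ c ∈ (torsionData L p v hv).plus, ∃ τ ∈ inertia v,
          ∃ c' ∈ (torsionData L p v hv).plus, τ • c' - c' = c) ∧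
      nonPrimitiveSelmerInfty W κ (↑S₀ : Set (HeightOneSpectrum (𝓞 ℚ))) ≤
        gvSelmerInfty κ (W.geomPrimaryTorsion p) L (↑S₀ : Set (HeightOneSpectrum (𝓞 ℚ))) ∧
      Nat.card ↥(gvSelmerInfty κ (W.geomPrimaryTorsion p) L (↑S₀ : Set (HeightOneSpectrum (𝓞 ℚ))) ⊓
          (subgroupH1 κ.kerSubgroup (W.geomPrimaryTorsion p))[(p : ℤ)]) =
        p ^ (lambdaInvariant p D.X + ∑ v ∈ S₀, delta W p v +
          (if W.HasSplitMultiplicativeReductionAtPrime p then 1 else 0)) := by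
  by_cases hsplit : W.HasSplitMultiplicativeReductionAtPrime p
  · obtain ⟨L, htriv, hgen, heq, hcard⟩ :=
      GreenbergSelmerCountSplit.exists_data_natCard_gvSelmerInfty_inf_torsion_eq_pow_of_split W p κ S₀
        hT' hA hB hF hκ hγ hp2 hsplit hS₀ hS D hX hμ
    refine ⟨L, htriv, hgen, heq.le.trans (gvStrictSelmerInfty_le_gvSelmerInfty κ _ L _), ?_⟩
    rw [if_pos hsplit]; exact hcard
  · obtain ⟨L, htriv, hgen, heq, hcard⟩ :=
      GreenbergSelmerCountNonsplit.exists_data_natCard_gvSelmerInfty_inf_torsion_eq_pow_of_not_split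
        W p κ S₀ hT hA hB hκ hγ hp2 hmult hsplit hS₀ hS D hX hμ
    refine ⟨L, htriv, hgen, heq.le, ?_⟩
    rw [if_neg hsplit, add_zero]; exact hcard

/-- **Tate data above an odd `p ‖ N` with `htriv`, `hgen` and `Sel^{Σ₀}_E(ℚ_∞)_p ≤ S^{Σ₀}_{E[p^∞]}(ℚ_∞)`**
— no `μ` hypothesis (split: `Sel^{Σ₀} = S^{Σ₀,str} ≤ S^{Σ₀}`; non-split: `=`).
[cite: GreenbergVatsal2000, §2 pp. 14–16] -/
theorem exists_data_le_multiplicative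
    (hT : Silverman1994_thmV53_corV54_tateUniformisation.{0})
    (hT' : Silverman1994_thmV53_tateUniformisation.{0})
    (hκ : κ.IsCyclotomic) (hp2 : p ≠ 2) (hmult : W.HasMultiplicativeReductionAtPrime p)
    (hS₀ : ∀ v ∈ S₀, ((p : ℕ) : 𝓞 ℚ) ∉ v.asIdeal)
    (hS : ∀ v : HeightOneSpectrum (𝓞 ℚ), v ∉ S₀ → ((p : ℕ) : 𝓞 ℚ) ∉ v.asIdeal →
      W.HasGoodReductionAt v) :
    ∃ L : Data ℚ (W.geomPrimaryTorsion p) p,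
      (∀ (v : HeightOneSpectrum (𝓞 ℚ)) (hv : ((p : ℕ) : 𝓞 ℚ) ∈ v.asIdeal),
        ∀ x ∈ inertia v, ∀ m : W.geomPrimaryTorsion p, x • m - m ∈ (L v hv).plus) ∧
      (∀ (v : HeightOneSpectrum (𝓞 ℚ)) (hv : ((p : ℕ) : 𝓞 ℚ) ∈ v.asIdeal),
        ∀ c ∈ (torsionData L p v hv).plus, ∃ τ ∈ inertia v,
          ∃ c' ∈ (torsionData L p v hv).plus, τ • c' - c' = c) ∧
      nonPrimitiveSelmerInfty W κ (↑S₀ : Set (HeightOneSpectrum (𝓞 ℚ))) ≤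
        gvSelmerInfty κ (W.geomPrimaryTorsion p) L (↑S₀ : Set (HeightOneSpectrum (𝓞 ℚ))) := by
  have hS₀'' : ∀ v ∈ (↑S₀ : Set (HeightOneSpectrum (𝓞 ℚ))), ((p : ℕ) : 𝓞 ℚ) ∉ v.asIdeal :=
    fun v hv ↦ hS₀ v (Finset.mem_coe.1 hv)
  have hS' : ∀ v : HeightOneSpectrum (𝓞 ℚ), v ∉ (↑S₀ : Set (HeightOneSpectrum (𝓞 ℚ))) →
      ((p : ℕ) : 𝓞 ℚ) ∉ v.asIdeal → W.HasGoodReductionAt v :=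
    fun v hv hpv ↦ hS v (fun h ↦ hv (Finset.mem_coe.2 h)) hpv
  by_cases hsplit : W.HasSplitMultiplicativeReductionAtPrime p
  · obtain ⟨L, htriv, hgen, -, -, hle, hge⟩ := exists_data_of_split W p κ hT' hp2 hsplit
    have heq := nonPrimitiveSelmerInfty_eq_gvStrictSelmerInfty_of_le W p κ L _ hp2 hκ hS₀'' hS' hle hge
    exact ⟨L, htriv, hgen, heq.le.trans (gvStrictSelmerInfty_le_gvSelmerInfty κ _ L _)⟩
  · obtain ⟨L, htriv, hgen, -, heqK, hle, hge⟩ := exists_data_of_not_split W p κ hT hκ hp2 hmult hsplit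
    have heq := nonPrimitiveSelmerInfty_eq_gvStrictSelmerInfty_of_le W p κ L _ hp2 hκ hS₀'' hS' hle hge
    exact ⟨L, htriv, hgen, heq.le.trans (gvStrictSelmerInfty_le_gvSelmerInfty κ _ L _)⟩

/-! ## §2. `μ`-readings from finiteness -/

/-- **`μ(E) = 0` at an odd `p ‖ N` from `#(S^{Σ₀}_{E[p^∞]}(ℚ_∞) ⊓ H¹[p]) ≠ 0`** for any data `L`
with `Sel^{Σ₀}_E(ℚ_∞)_p ≤ S^{Σ₀}(L)` (`D` f.g. torsion): then `Sel^{Σ₀}[p]` is finite and K-A's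
`μ`-reading (GV (7) at `p ‖ N`, `hA`) applies. The `μ`-half of the route-G transfer INTO the
multiplicative member. [cite: GreenbergVatsal2000, §1 (7) p. 8; §2 Prop. (2.8), p. 27] -/
theorem mu_eq_zero_of_natCard_ne_zero_multiplicative
    (hA : lambda_nonPrimitive_eq_add_sum_delta_multiplicative)
    (hκ : κ.IsCyclotomic) (hγ : κ.IsTopGenerator γ) (hp2 : p ≠ 2)
    (hmult : W.HasMultiplicativeReductionAtPrime p)
    (hS₀ : ∀ v ∈ S₀, ((p : ℕ) : 𝓞 ℚ) ∉ v.asIdeal)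
    (L : Data ℚ (W.geomPrimaryTorsion p) p)
    (hle : nonPrimitiveSelmerInfty W κ (↑S₀ : Set (HeightOneSpectrum (𝓞 ℚ))) ≤
      gvSelmerInfty κ (W.geomPrimaryTorsion p) L (↑S₀ : Set (HeightOneSpectrum (𝓞 ℚ))))
    (hne : Nat.card ↥(gvSelmerInfty κ (W.geomPrimaryTorsion p) L (↑S₀ : Set (HeightOneSpectrum (𝓞 ℚ))) ⊓
      (subgroupH1 κ.kerSubgroup (W.geomPrimaryTorsion p))[(p : ℤ)]) ≠ 0)
    (D : W.SelmerDualData κ γ) [Module.Finite (IwasawaAlgebra p) D.X] (hX : D.IsTorsion) :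
    D.mu = 0 := by
  haveI : Finite ↥(gvSelmerInfty κ (W.geomPrimaryTorsion p) L (↑S₀ : Set (HeightOneSpectrum (𝓞 ℚ))) ⊓
      (subgroupH1 κ.kerSubgroup (W.geomPrimaryTorsion p))[(p : ℤ)]) := Nat.finite_of_card_ne_zero hne
  haveI : Finite ↥(nonPrimitiveSelmerInfty W κ (↑S₀ : Set (HeightOneSpectrum (𝓞 ℚ))) ⊓
      (subgroupH1 κ.kerSubgroup (W.geomPrimaryTorsion p))[(p : ℤ)]) :=
    TrivialZeroCorankAlgebra.finite_inf_torsionBy_of_le (p : ℤ) hle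
  haveI : Finite ((nonPrimitiveSelmerInfty W κ (↑S₀ : Set (HeightOneSpectrum (𝓞 ℚ))))[(p : ℤ)]) :=
    (GreenbergSelmerCountNonsplit.finite_inf_torsionBy_iff _ _).1 inferInstance
  exact mu_eq_zero_of_finite_torsionBy_nonPrimitiveSelmerInfty_multiplicative W S₀ hA hp2 hmult hκ hγ
    hS₀ D hX

/-- **`μ(E) = 0` at a good ORDINARY odd `p` from `#(S^{Σ₀}_{E[p^∞]}(ℚ_∞) ⊓ H¹[p]) ≠ 0`** (Greenberg's
datum; `Σ₀ ∌ p` containing the bad primes; `D` f.g. torsion): `Sel^{Σ₀}_E(ℚ_∞)_p = S^{Σ₀}` (GV p. 26,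
`hGV` = A111) so `Sel^{Σ₀}[p]` is finite, `X^{Σ₀}/p` is finite, `μ(X^{Σ₀}) = 0` (GV Prop. (2.8)),
`μ(E) = μ(X^{Σ₀})` (GV (7), `hA` = A115) — gen 11's `MuTransferDerived` argument, isolated. The
`μ`-half of the route-G transfer INTO the good-ordinary member.
[cite: GreenbergVatsal2000, §1 (7) p. 8; §2 Prop. (2.8), pp. 26–27] -/
theorem mu_eq_zero_of_natCard_ne_zero_goodOrdinary
    (hGV : imKummer_ge_greenbergCondition_at_p) (hA : lambda_nonPrimitive_eq_add_sum_delta)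
    (hκ : κ.IsCyclotomic) (hγ : κ.IsTopGenerator γ) (hp2 : p ≠ 2)
    (hgood : W.HasGoodReductionAtPrime p) (hord : ¬ (p : ℤ) ∣ W.frobeniusTrace p)
    (hS₀ : ∀ v ∈ S₀, ((p : ℕ) : 𝓞 ℚ) ∉ v.asIdeal)
    (hS : ∀ v : HeightOneSpectrum (𝓞 ℚ), v ∉ S₀ → ((p : ℕ) : 𝓞 ℚ) ∉ v.asIdeal →
      W.HasGoodReductionAt v)
    (hne : Nat.card ↥(gvSelmerInfty κ (W.geomPrimaryTorsion p)
      (reductionData W p (W.not_dvd_minimalDiscriminantInt_of_hasGoodReductionAtPrime' p hgood))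
      (↑S₀ : Set (HeightOneSpectrum (𝓞 ℚ))) ⊓
      (subgroupH1 κ.kerSubgroup (W.geomPrimaryTorsion p))[(p : ℤ)]) ≠ 0)
    (D : W.SelmerDualData κ γ) [Module.Finite (IwasawaAlgebra p) D.X] (hX : D.IsTorsion) :
    D.mu = 0 := by
  have hΔ := W.not_dvd_minimalDiscriminantInt_of_hasGoodReductionAtPrime' p hgood
  have hbridge := natCard_torsionBy_nonPrimitiveSelmerInfty_eq W p κ
    (↑S₀ : Set (HeightOneSpectrum (𝓞 ℚ))) hGV hp2 hΔ hord hκ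
    (fun v hv ↦ hS₀ v (Finset.mem_coe.1 hv))
    (fun v hv hpv ↦ hS v (fun h ↦ hv (Finset.mem_coe.2 h)) hpv)
  have hne' : Nat.card ((nonPrimitiveSelmerInfty W κ
      (↑S₀ : Set (HeightOneSpectrum (𝓞 ℚ))))[(p : ℤ)]) ≠ 0 := by
    rw [hbridge]; exact hne
  haveI : Finite ((nonPrimitiveSelmerInfty W κ (↑S₀ : Set (HeightOneSpectrum (𝓞 ℚ))))[(p : ℤ)]) :=
    Nat.finite_of_card_ne_zero hne'
  set DS := nonPrimitiveDualData W κ (↑S₀ : Set (HeightOneSpectrum (𝓞 ℚ))) hγ with hDS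
  obtain ⟨hfg, htors, hmu, -⟩ := hA W p hp2 hgood hord κ hκ γ hγ S₀ hS₀ D DS hX
  haveI := hfg
  haveI : Finite (ModN (CharacterModule
      (nonPrimitiveSelmerInfty W κ (↑S₀ : Set (HeightOneSpectrum (𝓞 ℚ))))) p) :=
    MuTransferDerived.finite_modN_characterModule_of_finite_torsionBy p
  have hfin : Finite (ModN DS.X p) :=
    Finite.of_equiv _ (modNEquiv (toDualEquiv W κ _ DS) p).symm.toEquiv
  have hμS : muInvariant p DS.X = 0 :=
    MuVanishingOfFiniteModP.muInvariant_eq_zero_of_finite_modN' p DS.X htors hfin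
  change muInvariant p D.X = 0
  rw [← hmu]; exact hμS

end Summit.BirchSwinnertonDyer.Rank1Residual.X2.GreenbergSelmerCountMultiplicative

end
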